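import Literature.NumberTheory.Sieve.LargeSieveConductorTail
import Literature.NumberTheory.Sieve.BombieriVinogradovReduction
import HarnessLib

/-!
# The large-sieve half of the Barban–Davenport–Halberstam theorem: characters of conductor `> R`
# to all moduli `h ≤ Q`, with the weight `1/φ` — proved

For complex `a_n` supported on `(M₀, M₀ + N]` the multiplicative large sieve
(`largeSieve_character_nat`, `∑_{r ≤ t} (r/φ(r)) ∑*_{ψ mod r} |∑ a_n ψ(n)|² ≤ (N + 1 + 2t²) ∑|a_n|²`)
gives by partial summation with the weight `r⁻¹`

`∑_{R < r ≤ Q} φ(r)⁻¹ ∑*_{ψ mod r} |∑_n a_n ψ(n)|² ≤ (2(N+1)/R + 4Q) ∑_n |a_n|²`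

(`largeSieve_character_totient_tail`), and — grouping the characters `χ mod h`, `h ≤ Q`, of conductor
`r > R` under the primitive characters inducing them (the tree's index set `primIndex h` / `induce h`)
and using `∑_{h ≤ Q, r ∣ h} 1/φ(h) ≤ W(Q)/φ(r)`, `W(Q) ≤ (1 + log Q)²` (`sum_filter_dvd_totient_inv_le`,
`totientInvSum_le`) — the bound for ALL moduli at once:

`∑_{h ≤ Q} φ(h)⁻¹ ∑_{χ mod h, cond χ > R} |∑_n a_n χ(n)|² ≤ (1 + log Q)²·(2(N+1)/R + 4Q)·∑_n |a_n|²`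

(`sum_totient_inv_largeConductor_le`, stated over `primIndex h` with the side condition that the support
of `a` is coprime to every modulus `h ≤ Q`, e.g. `a` supported on primes `> Q`, so that an induced
character and its primitive inducer agree on the support: private `sum_mul_induce_eq`). This is the
"large-sieve half" of the Barban–Davenport–Halberstam theorem (Davenport ch. 29; Iwaniec–Kowalski
Thm 17.4's proof): by Parseval over the reduced classes it controls the mean square, over all moduli
`h ≤ Q` and all classes, of the part of `∑_{n ≡ c (h)} a_n` carried by characters of conductor `> R`
— with the saving `R⁻¹` on the `N`-term that the Siegel–Walfisz range `cond ≤ R` cannot give. Nothing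
about primes is used or claimed: a pure inequality for finite sequences. Standard axioms.

## References
* [Davenport1980] H. Davenport, *Multiplicative Number Theory*, 2nd ed., Springer GTM 74, ch. 29
  (Barban–Davenport–Halberstam: reduction to primitive characters + large sieve) — derivation.
* [IwaniecKowalski2004] H. Iwaniec, E. Kowalski, *Analytic Number Theory*, AMS Coll. Publ. 53,
  Thm 7.13 (large sieve for characters) — derivation.
* [Drappeau2017] S. Drappeau, Proc. LMS 114 (2017), Lemma 3.3 (the `r⁻²`-weighted tail, tree
  `largeSieve_character_tail`; same partial summation) — derivation.
-/

noncomputable section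

open Finset Real

namespace Literature.NumberTheory.Sieve.LargeSieve

/-- Telescoping: `∑_{t=r}^{Q} (t⁻¹ − (t+1)⁻¹) = r⁻¹ − (Q+1)⁻¹` for `1 ≤ r ≤ Q + 1`. [folklore] -/
private theorem sum_Icc_inv_sub_inv_succ (r : ℕ) (hr : 1 ≤ r) :
    ∀ Q : ℕ, r ≤ Q + 1 →
      ∑ t ∈ Icc r Q, (((t : ℝ))⁻¹ - ((t : ℝ) + 1)⁻¹) = ((r : ℝ))⁻¹ - ((Q : ℝ) + 1)⁻¹ := by
  intro Q
  induction Q with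
  | zero =>
    intro hrQ
    have h1 : r = 1 := le_antisymm hrQ hr
    subst h1
    simp
  | succ Q ih =>
    intro hrQ
    rcases Nat.lt_or_ge (Q + 1) r with h | h
    · have hr' : r = Q + 2 := by omega
      subst hr'
      rw [Finset.Icc_eq_empty (by omega), Finset.sum_empty]
      push_cast
      ring
    · rw [Finset.sum_Icc_succ_top h, ih h]
      push_cast
      ring

open scoped Classical in
/-- **The large sieve over conductors `> R` with the weight `φ(r)⁻¹`**: for complex `a_n` on
`(M₀, M₀ + N]` and `1 ≤ R`,
`∑_{R < r ≤ Q} φ(r)⁻¹ ∑_{ψ mod r primitive} |∑_n a_n ψ(n)|² ≤ (2(N+1)/R + 4Q) ∑_n |a_n|²`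
(partial summation with the weight `r⁻¹` from `∑_{r ≤ t} (r/φ(r)) ∑*_ψ |…|² ≤ (N + 1 + 2t²) ∑|a_n|²`).
[cite: Davenport1980, ch. 29 — derivation; IwaniecKowalski2004, Thm 7.13 — derivation] -/
theorem largeSieve_character_totient_tail (a : ℕ → ℂ) (M₀ N R Q : ℕ) (hR : 1 ≤ R) :
    ∑ r ∈ Ioc R Q, ((r.totient : ℝ))⁻¹ *
        ∑ χ : DirichletCharacter ℂ r with χ.IsPrimitive, ‖∑ n ∈ Ioc M₀ (M₀ + N), a n * χ n‖ ^ 2 ≤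
      (2 * ((N : ℝ) + 1) / R + 4 * Q) * ∑ n ∈ Ioc M₀ (M₀ + N), ‖a n‖ ^ 2 := by
  classical
  set S := ∑ n ∈ Ioc M₀ (M₀ + N), ‖a n‖ ^ 2 with hS
  have hS0 : 0 ≤ S := Finset.sum_nonneg fun _ _ => by positivity
  have hR0 : (0 : ℝ) < R := by exact_mod_cast hR
  -- `h r = ∑*_ψ |…|²`, `g r = (r/φ(r)) h r`, and `φ(r)⁻¹ h r = r⁻¹ g r`
  set h : ℕ → ℝ := fun r =>
    ∑ χ : DirichletCharacter ℂ r with χ.IsPrimitive, ‖∑ n ∈ Ioc M₀ (M₀ + N), a n * χ n‖ ^ 2 with hh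
  set g : ℕ → ℝ := fun r => (r : ℝ) / r.totient * h r with hg
  have hh0 : ∀ r, 0 ≤ h r := fun r => Finset.sum_nonneg fun _ _ => by positivity
  have hg0 : ∀ r, 0 ≤ g r := fun r =>
    mul_nonneg (div_nonneg (Nat.cast_nonneg _) (Nat.cast_nonneg _)) (hh0 r)
  have hphi : ∀ r, 1 ≤ r → ((r.totient : ℝ))⁻¹ * h r = ((r : ℝ))⁻¹ * g r := by
    intro r hr1
    have hφ : (0 : ℝ) < r.totient := by exact_mod_cast Nat.totient_pos.2 hr1
    have hr0 : (0 : ℝ) < r := by exact_mod_cast hr1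
    simp only [hg]
    field_simp
  -- the large sieve at level `t`
  have hLS : ∀ t : ℕ, ∑ r ∈ Icc 1 t, g r ≤ ((N : ℝ) + 1 + 2 * (t : ℝ) ^ 2) * S := fun t =>
    largeSieve_character_nat a M₀ N t
  have hinner : ∀ t, ∑ r ∈ Ioc R t, g r ≤ ((N : ℝ) + 1 + 2 * (t : ℝ) ^ 2) * S := fun t =>
    (Finset.sum_le_sum_of_subset_of_nonneg
      (fun r hr => by simp only [mem_Ioc, mem_Icc] at hr ⊢; omega) (fun r _ _ => hg0 r)).trans (hLS t)
  have hLHS : ∑ r ∈ Ioc R Q, ((r.totient : ℝ))⁻¹ * h r = ∑ r ∈ Ioc R Q, ((r : ℝ))⁻¹ * g r :=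
    Finset.sum_congr rfl fun r hr => hphi r (by have := (mem_Ioc.1 hr).1; omega)
  change ∑ r ∈ Ioc R Q, ((r.totient : ℝ))⁻¹ * h r ≤ (2 * ((N : ℝ) + 1) / R + 4 * Q) * S
  rw [hLHS]
  clear_value S h g
  clear hLHS hphi
  -- trivial case: no `r`
  rcases Nat.lt_or_ge Q (R + 1) with hQR | hQR
  · rw [Finset.Ioc_eq_empty (by omega), Finset.sum_empty]
    exact mul_nonneg (by positivity) hS0
  -- main case `R + 1 ≤ Q`; weights `w t = t⁻¹ − (t+1)⁻¹ ≥ 0`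
  set w : ℕ → ℝ := fun t => ((t : ℝ))⁻¹ - ((t : ℝ) + 1)⁻¹ with hw
  have hw0 : ∀ t, 1 ≤ t → 0 ≤ w t := by
    intro t ht
    have ht0 : (0 : ℝ) < t := by exact_mod_cast ht
    exact sub_nonneg.2 (inv_anti₀ ht0 (by linarith))
  -- Step 1: `r⁻¹ = (Q+1)⁻¹ + ∑_{t=r}^{Q} w t`
  have step1 : ∑ r ∈ Ioc R Q, ((r : ℝ))⁻¹ * g r =
      ∑ r ∈ Ioc R Q, ((Q : ℝ) + 1)⁻¹ * g r + ∑ r ∈ Ioc R Q, ∑ t ∈ Icc r Q, w t * g r := by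
    rw [← Finset.sum_add_distrib]
    refine Finset.sum_congr rfl fun r hr => ?_
    have hr1 : 1 ≤ r := by have := (mem_Ioc.1 hr).1; omega
    have hrQ : r ≤ Q + 1 := by have := (mem_Ioc.1 hr).2; omega
    have hid : ((r : ℝ))⁻¹ = ((Q : ℝ) + 1)⁻¹ + ∑ t ∈ Icc r Q, w t := by
      rw [sum_Icc_inv_sub_inv_succ r hr1 Q hrQ]; ring
    rw [hid, add_mul, Finset.sum_mul]
  -- Step 2: exchange the summations over `R < r ≤ t ≤ Q`
  have step2 : ∑ r ∈ Ioc R Q, ∑ t ∈ Icc r Q, w t * g r =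
      ∑ t ∈ Ioc R Q, w t * ∑ r ∈ Ioc R t, g r := by
    rw [Finset.sum_comm' (s' := fun t => Ioc R t) (t' := Ioc R Q)]
    · exact Finset.sum_congr rfl fun t _ => by rw [Finset.mul_sum]
    · intro r t
      simp only [mem_Ioc, mem_Icc]
      omega
  -- Step 3: the large sieve inside
  have step3a : ∑ r ∈ Ioc R Q, ((Q : ℝ) + 1)⁻¹ * g r ≤
      ((Q : ℝ) + 1)⁻¹ * (((N : ℝ) + 1 + 2 * (Q : ℝ) ^ 2) * S) := by
    rw [← Finset.mul_sum]
    exact mul_le_mul_of_nonneg_left (hinner Q) (by positivity)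
  have step3b : ∑ t ∈ Ioc R Q, w t * ∑ r ∈ Ioc R t, g r ≤
      ∑ t ∈ Ioc R Q, w t * (((N : ℝ) + 1 + 2 * (t : ℝ) ^ 2) * S) :=
    Finset.sum_le_sum fun t ht =>
      mul_le_mul_of_nonneg_left (hinner t) (hw0 t (by have := (mem_Ioc.1 ht).1; omega))
  -- Step 4: the weight sums
  have hsumw : ∑ t ∈ Ioc R Q, w t ≤ ((R : ℝ))⁻¹ := by
    rw [← Finset.Icc_add_one_left_eq_Ioc, sum_Icc_inv_sub_inv_succ (R + 1) (by omega) Q (by omega)]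
    have h1 : (((R + 1 : ℕ) : ℝ))⁻¹ ≤ ((R : ℝ))⁻¹ :=
      inv_anti₀ hR0 (by push_cast; linarith)
    have h2 : 0 ≤ ((Q : ℝ) + 1)⁻¹ := by positivity
    linarith
  have hsumtw : ∑ t ∈ Ioc R Q, w t * (2 * (t : ℝ) ^ 2) ≤ 2 * (Q : ℝ) := by
    have hpt : ∀ t ∈ Ioc R Q, w t * (2 * (t : ℝ) ^ 2) ≤ 2 := by
      intro t ht
      have ht1 : (1 : ℝ) ≤ t := by exact_mod_cast (show 1 ≤ t by have := (mem_Ioc.1 ht).1; omega)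
      have ht0 : (0 : ℝ) < t := by linarith
      have hw' : w t * (2 * (t : ℝ) ^ 2) = 2 * t / ((t : ℝ) + 1) := by
        simp only [hw]
        field_simp
        ring
      rw [hw', div_le_iff₀ (by positivity)]
      linarith
    calc ∑ t ∈ Ioc R Q, w t * (2 * (t : ℝ) ^ 2) ≤ ∑ t ∈ Ioc R Q, (2 : ℝ) := Finset.sum_le_sum hpt
      _ = 2 * ((Q - R : ℕ) : ℝ) := by rw [Finset.sum_const, Nat.card_Ioc, nsmul_eq_mul]; ring
      _ ≤ 2 * (Q : ℝ) := by
        have : ((Q - R : ℕ) : ℝ) ≤ Q := by exact_mod_cast Nat.sub_le Q R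
        linarith
  -- Step 5: assemble
  clear_value w
  have hQ1R : (R : ℝ) ≤ (Q : ℝ) + 1 := by exact_mod_cast (by omega : R ≤ Q + 1)
  have hA : ((Q : ℝ) + 1)⁻¹ * (((N : ℝ) + 1 + 2 * (Q : ℝ) ^ 2) * S) ≤
      (((N : ℝ) + 1) / R + 2 * Q) * S := by
    rw [← mul_assoc]
    refine mul_le_mul_of_nonneg_right ?_ hS0
    rw [mul_add]
    refine add_le_add ?_ ?_
    · rw [div_eq_mul_inv, mul_comm]
      exact mul_le_mul_of_nonneg_left (inv_anti₀ hR0 hQ1R) (by positivity)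
    · rw [← div_eq_inv_mul, div_le_iff₀ (by positivity)]
      have hQ0 : (0 : ℝ) ≤ Q := Nat.cast_nonneg Q
      nlinarith
  have hB : ∑ t ∈ Ioc R Q, w t * (((N : ℝ) + 1 + 2 * (t : ℝ) ^ 2) * S) ≤
      (((N : ℝ) + 1) / R + 2 * Q) * S := by
    have hsplit : ∑ t ∈ Ioc R Q, w t * (((N : ℝ) + 1 + 2 * (t : ℝ) ^ 2) * S) =
        (((N : ℝ) + 1) * ∑ t ∈ Ioc R Q, w t + ∑ t ∈ Ioc R Q, w t * (2 * (t : ℝ) ^ 2)) * S := by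
      rw [Finset.mul_sum, ← Finset.sum_add_distrib, Finset.sum_mul]
      exact Finset.sum_congr rfl fun t _ => by ring
    rw [hsplit]
    refine mul_le_mul_of_nonneg_right (add_le_add ?_ hsumtw) hS0
    rw [div_eq_mul_inv]
    exact mul_le_mul_of_nonneg_left hsumw (by positivity)
  calc ∑ r ∈ Ioc R Q, ((r : ℝ))⁻¹ * g r
      = ∑ r ∈ Ioc R Q, ((Q : ℝ) + 1)⁻¹ * g r + ∑ t ∈ Ioc R Q, w t * ∑ r ∈ Ioc R t, g r := by
        rw [step1, step2]
    _ ≤ (((N : ℝ) + 1) / R + 2 * Q) * S + (((N : ℝ) + 1) / R + 2 * Q) * S :=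
        add_le_add (step3a.trans hA) (step3b.trans hB)
    _ = (2 * ((N : ℝ) + 1) / R + 4 * Q) * S := by ring

/-! ### All moduli `h ≤ Q`: characters of conductor `> R` -/

open scoped Classical in
/-- On a support coprime to the modulus, an induced character and its primitive inducer agree:
for `σ = (d, ψ) ∈ S(h)` and `a_n = 0` unless `(n, h) = 1`,
`∑_n a_n (induce h σ)(n) = ∑_n a_n ψ(n)`. [folklore] -/
private theorem sum_mul_induce_eq {h : ℕ} {σ : Σ d : ℕ, DirichletCharacter ℂ d} (hσ : σ ∈ primIndex h)
    (a : ℕ → ℂ) (M₀ N : ℕ) (hcop : ∀ n ∈ Ioc M₀ (M₀ + N), a n ≠ 0 → n.Coprime h) :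
    ∑ n ∈ Ioc M₀ (M₀ + N), a n * induce h σ n = ∑ n ∈ Ioc M₀ (M₀ + N), a n * σ.2 n := by
  obtain ⟨hd, -, -⟩ := mem_primIndex.1 hσ
  refine Finset.sum_congr rfl fun n hn => ?_
  by_cases han : a n = 0
  · simp [han]
  · have hc : IsCoprime (n : ℤ) (h : ℤ) := Nat.isCoprime_iff_coprime.mpr (hcop n hn han)
    rw [induce, dif_pos hd]
    congr 1
    have := DirichletCharacter.changeLevel_eq_cast_of_dvd' σ.2 hd hc
    simpa only [Int.cast_natCast] using this

open scoped Classical in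
/-- **The large-sieve half of Barban–Davenport–Halberstam.** For complex `a_n` on `(M₀, M₀ + N]`
whose support is coprime to every modulus `h ≤ Q` (e.g. supported on primes `> Q`), and `1 ≤ R`:
`∑_{h ≤ Q} φ(h)⁻¹ ∑_{(d,ψ) ∈ S(h), d > R} |∑_n a_n ψ_h(n)|² ≤ (1 + log Q)²·(2(N+1)/R + 4Q)·∑_n |a_n|²`,
where `S(h) = primIndex h` indexes the characters `χ = ψ_h = induce h (d,ψ)` mod `h` by their conductor
`d` and primitive inducer `ψ` (so the inner sum runs over the characters mod `h` of conductor `> R`).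
[cite: Davenport1980, ch. 29 — derivation; IwaniecKowalski2004, Thm 7.13 — derivation] -/
theorem sum_totient_inv_largeConductor_le (a : ℕ → ℂ) (M₀ N R Q : ℕ) (hR : 1 ≤ R)
    (hcop : ∀ n ∈ Ioc M₀ (M₀ + N), a n ≠ 0 → ∀ h ∈ Icc 1 Q, n.Coprime h) :
    ∑ h ∈ Icc 1 Q, ((h.totient : ℝ))⁻¹ *
        ∑ σ ∈ (primIndex h).filter (fun σ => R < σ.1),
          ‖∑ n ∈ Ioc M₀ (M₀ + N), a n * induce h σ n‖ ^ 2 ≤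
      (1 + Real.log Q) ^ 2 * (2 * ((N : ℝ) + 1) / R + 4 * Q) *
        ∑ n ∈ Ioc M₀ (M₀ + N), ‖a n‖ ^ 2 := by
  classical
  set S := ∑ n ∈ Ioc M₀ (M₀ + N), ‖a n‖ ^ 2 with hS
  have hS0 : 0 ≤ S := Finset.sum_nonneg fun _ _ => by positivity
  -- `P d = ∑*_{ψ mod d} |∑ a ψ|²` and `F d = 𝟙[R < d] P d`
  set P : ℕ → ℝ := fun d =>
    ∑ ψ : DirichletCharacter ℂ d with ψ.IsPrimitive, ‖∑ n ∈ Ioc M₀ (M₀ + N), a n * ψ n‖ ^ 2 with hP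
  set F : ℕ → ℝ := fun d => if R < d then P d else 0 with hF
  have hP0 : ∀ d, 0 ≤ P d := fun d => Finset.sum_nonneg fun _ _ => by positivity
  have hF0 : ∀ d, 0 ≤ F d := fun d => by
    simp only [hF]; split_ifs
    · exact hP0 d
    · exact le_rfl
  -- the inner sum at modulus `h` equals `∑_{d ∣ h} F d`
  have hinner : ∀ h ∈ Icc 1 Q,
      ∑ σ ∈ (primIndex h).filter (fun σ => R < σ.1),
          ‖∑ n ∈ Ioc M₀ (M₀ + N), a n * induce h σ n‖ ^ 2 = ∑ d ∈ h.divisors, F d := by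
    intro h hh
    have hcop' : ∀ n ∈ Ioc M₀ (M₀ + N), a n ≠ 0 → n.Coprime h := fun n hn han => hcop n hn han h hh
    rw [Finset.sum_filter]
    have : ∑ σ ∈ primIndex h, (if R < σ.1 then
        ‖∑ n ∈ Ioc M₀ (M₀ + N), a n * induce h σ n‖ ^ 2 else 0) =
        ∑ σ ∈ primIndex h, (if R < σ.1 then ‖∑ n ∈ Ioc M₀ (M₀ + N), a n * σ.2 n‖ ^ 2 else 0) := by
      refine Finset.sum_congr rfl fun σ hσ => ?_
      rw [sum_mul_induce_eq hσ a M₀ N hcop']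
    rw [this, primIndex, Finset.sum_sigma]
    refine Finset.sum_congr rfl fun d _ => ?_
    simp only [hF, hP]
    by_cases hRd : R < d
    · simp only [hRd, if_true]
    · simp only [hRd, if_false, Finset.sum_const_zero]
  -- exchange `h` and `d`, and bound `∑_{h ≤ Q, d ∣ h} 1/φ(h)`
  have hswap : ∑ h ∈ Icc 1 Q, ((h.totient : ℝ))⁻¹ * ∑ d ∈ h.divisors, F d =
      ∑ d ∈ Icc 1 Q, F d * ∑ h ∈ Icc 1 Q with d ∣ h, ((h.totient : ℝ))⁻¹ :=
    sum_mul_sum_divisors_eq Q (fun h => ((h.totient : ℝ))⁻¹) F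
  have hW : ∀ d ∈ Icc 1 Q, F d * ∑ h ∈ Icc 1 Q with d ∣ h, ((h.totient : ℝ))⁻¹ ≤
      totientInvSum Q * (((d.totient : ℝ))⁻¹ * F d) := by
    intro d hd
    have hd1 : 1 ≤ d := (mem_Icc.1 hd).1
    calc F d * ∑ h ∈ Icc 1 Q with d ∣ h, ((h.totient : ℝ))⁻¹
        ≤ F d * (((d.totient : ℝ))⁻¹ * totientInvSum Q) :=
          mul_le_mul_of_nonneg_left (sum_filter_dvd_totient_inv_le Q hd1) (hF0 d)
      _ = totientInvSum Q * (((d.totient : ℝ))⁻¹ * F d) := by ring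
  -- `∑_{d ≤ Q} φ(d)⁻¹ F d = ∑_{R < d ≤ Q} φ(d)⁻¹ P d`
  have hrange : ∑ d ∈ Icc 1 Q, ((d.totient : ℝ))⁻¹ * F d = ∑ d ∈ Ioc R Q, ((d.totient : ℝ))⁻¹ * P d := by
    have hsub : Ioc R Q ⊆ Icc 1 Q := fun d hd => by
      simp only [mem_Ioc, mem_Icc] at hd ⊢; omega
    rw [← Finset.sum_subset hsub]
    · refine Finset.sum_congr rfl fun d hd => ?_
      simp only [hF, (mem_Ioc.1 hd).1, if_true]
    · intro d hd hdn
      have : ¬ R < d := fun h' => hdn (mem_Ioc.2 ⟨h', (mem_Icc.1 hd).2⟩)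
      simp only [hF, this, if_false, mul_zero]
  have hlog : 0 ≤ 1 + Real.log Q := by
    have := Real.log_natCast_nonneg Q; linarith
  calc ∑ h ∈ Icc 1 Q, ((h.totient : ℝ))⁻¹ *
          ∑ σ ∈ (primIndex h).filter (fun σ => R < σ.1),
            ‖∑ n ∈ Ioc M₀ (M₀ + N), a n * induce h σ n‖ ^ 2
      = ∑ h ∈ Icc 1 Q, ((h.totient : ℝ))⁻¹ * ∑ d ∈ h.divisors, F d :=
        Finset.sum_congr rfl fun h hh => by rw [hinner h hh]
    _ = ∑ d ∈ Icc 1 Q, F d * ∑ h ∈ Icc 1 Q with d ∣ h, ((h.totient : ℝ))⁻¹ := hswap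
    _ ≤ ∑ d ∈ Icc 1 Q, totientInvSum Q * (((d.totient : ℝ))⁻¹ * F d) := Finset.sum_le_sum hW
    _ = totientInvSum Q * ∑ d ∈ Ioc R Q, ((d.totient : ℝ))⁻¹ * P d := by
        rw [← Finset.mul_sum, hrange]
    _ ≤ (1 + Real.log Q) ^ 2 * ((2 * ((N : ℝ) + 1) / R + 4 * Q) * S) := by
        refine mul_le_mul (totientInvSum_le Q) ?_ ?_ (by positivity)
        · exact largeSieve_character_totient_tail a M₀ N R Q hR
        · exact Finset.sum_nonneg fun d _ => mul_nonneg (inv_nonneg.2 (Nat.cast_nonneg _)) (hP0 d)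
    _ = (1 + Real.log Q) ^ 2 * (2 * ((N : ℝ) + 1) / R + 4 * Q) * S := by ring

end Literature.NumberTheory.Sieve.LargeSieve
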